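import Mathlib.MeasureTheory.Integral.Bochner.Basic
import Mathlib.MeasureTheory.Constructions.Pi
import HarnessLib

/-!
# The discrete (total-variation) site cost `υ(s, s') = 𝟙{s ≠ s'}` and the disagreement
# functionals `ν(I_ℓ) = ∫ υ(x_ℓ, y_ℓ) dν` of a measure on pairs of configurations

[topic Probability/TransportMaps]

[Presutti2009] E. Presutti, *Scaling Limits in Statistical Mechanics and Microstructures in Continuum
Mechanics*, Springer 2009, §3.2.3, Cor. 3.2.3.2 (p. 116): with the discrete distance `d(s, s') =
𝟙_{s ≠ s'}` the Wasserstein (Vaserstein) distance is the total-variation distance.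
[ConacheEtAl2015] D. Conache, Yu. Kondratiev, Yu. Kozitsky, T. Pasurek, arXiv:1501.00673, §2.1 and
§3.2 (18)–(19): `υ(ξ, η) = 1 − δ_{ξη}`, `I_ℓ = {(x, y) : x_ℓ ≠ y_ℓ}`, `ν(I_ℓ) = ∫ υ(x_ℓ, y_ℓ) ν(dx, dy)`,
`γ(ν) = sup_ℓ ν(I_ℓ)`.

THIS FILE isolates the elementary, Mathlib-only vocabulary shared by the tree's total-variation
coupling files (the Dobrushin comparison files in TV currency and the Dobrushin–Pechersky files):
`tvCost S : S × S → ℝ≥0∞` (the indicator of the off-diagonal), `tvCost_self`, `tvCost_of_ne`,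
`tvCost_le_one`, `tvCost_comm`, measurability when the diagonal is measurable, and the evaluation of
the site functionals `∫ υ(x_ℓ, y_ℓ) dν = ν{x_ℓ ≠ y_ℓ}` (as `lintegral` and as a real integral).
No named facts; nothing model-specific.

## References
* [Presutti2009] §3.2.3 Cor. 3.2.3.2, p. 116.
* [ConacheEtAl2015] arXiv:1501.00673, §3.2 (18)–(19).
-/

noncomputable section

open MeasureTheory Set

open scoped ENNReal NNReal

namespace Literature.Probability.TransportMaps

namespace TVDisagreement

variable {ι : Type*} {S : Type*}

variable (S) in
/-- The discrete cost `υ(s, s') = 𝟙_{s ≠ s'}` (the indicator of the off-diagonal).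
[cite: Presutti2009, §3.2.3 Cor. 3.2.3.2, p. 116] -/
def tvCost : S × S → ℝ≥0∞ := (Set.diagonal S)ᶜ.indicator 1

/-- `υ(s, s) = 0`. [cite: Presutti2009, §3.2.3 Cor. 3.2.3.2, p. 116] -/
@[simp] theorem tvCost_self (s : S) : tvCost S (s, s) = 0 := indicator_of_notMem (by simp) _

/-- `υ(s, s') = 1` for `s ≠ s'`. [cite: Presutti2009, §3.2.3 Cor. 3.2.3.2, p. 116] -/
theorem tvCost_of_ne {s s' : S} (h : s ≠ s') : tvCost S (s, s') = 1 :=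
  indicator_of_mem (by simpa [Set.mem_diagonal_iff] using h) _

/-- `υ ≤ 1`. [cite: Presutti2009, §3.2.3 Cor. 3.2.3.2, p. 116] -/
theorem tvCost_le_one (p : S × S) : tvCost S p ≤ 1 :=
  indicator_apply_le' (fun _ => le_rfl) fun _ => zero_le_one

/-- `υ < ∞`. [cite: Presutti2009, §3.2.3 Cor. 3.2.3.2, p. 116] -/
theorem tvCost_ne_top (p : S × S) : tvCost S p ≠ ∞ :=
  ne_top_of_le_ne_top ENNReal.one_ne_top (tvCost_le_one p)

/-- `υ` is symmetric. [cite: Presutti2009, §3.2.3 Cor. 3.2.3.2, p. 116] -/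
theorem tvCost_comm (s s' : S) : tvCost S (s, s') = tvCost S (s', s) := by
  by_cases h : s = s'
  · subst h; rfl
  · rw [tvCost_of_ne h, tvCost_of_ne (Ne.symm h)]

variable [MeasurableSpace S]

/-- `υ` is measurable when the diagonal is. [cite: Presutti2009, §3.2.3 Cor. 3.2.3.2, p. 116] -/
theorem measurable_tvCost (hΔ : MeasurableSet (Set.diagonal S)) : Measurable (tvCost S) :=
  measurable_one.indicator hΔ.compl

/-- The site disagreement `(x, y) ↦ υ(x_ℓ, y_ℓ)` is measurable when the diagonal is.
[cite: ConacheEtAl2015, §3.2 (18)–(19)] -/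
theorem measurable_tvCost_coord (hΔ : MeasurableSet (Set.diagonal S)) (i : ι) :
    Measurable fun x : (ι → S) × (ι → S) => tvCost S (x.1 i, x.2 i) :=
  (measurable_tvCost hΔ).comp (((measurable_pi_apply i).comp measurable_fst).prodMk
    ((measurable_pi_apply i).comp measurable_snd))

/-- `ν(I_ℓ) = ∫ υ(x_ℓ, y_ℓ) ν(dx, dy) = ν{x_ℓ ≠ y_ℓ}`. [cite: ConacheEtAl2015, §3.2 (18)–(19)] -/
theorem lintegral_tvCost_coord (hΔ : MeasurableSet (Set.diagonal S))
    (Q : Measure ((ι → S) × (ι → S))) (i : ι) :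
    ∫⁻ x, tvCost S (x.1 i, x.2 i) ∂Q = Q {x | x.1 i ≠ x.2 i} := by
  have hm : Measurable fun x : (ι → S) × (ι → S) => (x.1 i, x.2 i) :=
    ((measurable_pi_apply i).comp measurable_fst).prodMk ((measurable_pi_apply i).comp measurable_snd)
  have hset : {x : (ι → S) × (ι → S) | x.1 i ≠ x.2 i} =
      (fun x : (ι → S) × (ι → S) => (x.1 i, x.2 i)) ⁻¹' (Set.diagonal S)ᶜ := by
    ext x; simp [Set.mem_diagonal_iff]
  rw [hset, ← lintegral_indicator_one (hm hΔ.compl)]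
  rfl

/-- `∫ υ(x_ℓ, y_ℓ) dν ≤ 1` for a probability `ν`. [cite: ConacheEtAl2015, §3.2 (18)–(19)] -/
theorem lintegral_tvCost_coord_le_one (Q : Measure ((ι → S) × (ι → S))) [IsProbabilityMeasure Q]
    (i : ι) : ∫⁻ x, tvCost S (x.1 i, x.2 i) ∂Q ≤ 1 :=
  calc ∫⁻ x, tvCost S (x.1 i, x.2 i) ∂Q ≤ ∫⁻ _x, 1 ∂Q := lintegral_mono fun x => tvCost_le_one _
    _ = 1 := by simp

/-- The real form `∫ υ(x_ℓ, y_ℓ) dν = ν{x_ℓ ≠ y_ℓ}` (as `toReal`). [cite: ConacheEtAl2015, §3.2 (18)–(19)] -/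
theorem integral_toReal_tvCost_coord (hΔ : MeasurableSet (Set.diagonal S))
    (Q : Measure ((ι → S) × (ι → S))) [IsFiniteMeasure Q] (i : ι) :
    ∫ x, (tvCost S (x.1 i, x.2 i)).toReal ∂Q = (Q {x | x.1 i ≠ x.2 i}).toReal := by
  rw [integral_eq_lintegral_of_nonneg_ae (Filter.Eventually.of_forall fun _ => ENNReal.toReal_nonneg)
    (measurable_tvCost_coord hΔ i).ennreal_toReal.aestronglyMeasurable, ← lintegral_tvCost_coord hΔ Q i]
  congr 1
  refine lintegral_congr fun x => ?_
  exact ENNReal.ofReal_toReal (tvCost_ne_top _)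

end TVDisagreement

end Literature.Probability.TransportMaps
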